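import Literature.AlgebraicGeometry.ShimuraVarieties.UnitaryCurveAuxiliaryIntegralActionV
import Literature.AlgebraicGeometry.ShimuraVarieties.UnitaryAuxiliaryLevelProduct
import HarnessLib

/-!
# The auxiliary level sees only the LATTICE: a COMMON `K`-stable `𝓞_M`-lattice carries an adapted integral frame for EVERY skew scalar `ξ`,
# and all these frames have the SAME auxiliary levels `K̃_β(m)` (any rank `n`, any family of `ξ`)

Topic `AlgebraicGeometry/ShimuraVarieties`; namespace `Literature.AlgebraicGeometry.ShimuraVarieties.UnitaryCurve.AuxV`.
Theorems only (no definition, no named fact, no instance).  Cell `hodgecm-mathlib` (D-0151), FLOOR 0, P6 «MOD programme», door (E) of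
`stub_RGD`, organ **E1 FILE 7b-FAMILY** (the «COMMON LATTICE» law for the multi-frame E-witness head of `Cruxes/HLiu418/Lines/F0_P6a_PELWitnessE.lean`):
`--supports stmt-HodgeConjecture-24832`, count-neutral; HC_CM is proved only modulo the printed citations until rung 0 closes.

THE POINT ([Deligne1971TravauxShimura] Prop. 1.15 p. 132, Exemple 4.16 p. 150: the principal congruence subgroup `K(m)` of a lattice `Λ` is
`{u : (u - 1)Λ̂ ⊆ mΛ̂}` — it depends on `Λ` alone; [Kottwitz1992] §5 p. 390: ONE `𝒪_B`-lattice `Λ` for the PEL datum;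
[RapoportSmithlingZhang2020Diagonal] Remark 3.2 (ii)(iii) pp. 9–10): ★ 7b `exists_symplecticFrameV_integralAction` adapts, for ONE skew scalar
`ξ`, a symplectic frame `β` of `k•ψ_ξ` to a `K × L₀`-stable, `𝓞_M`-stable lattice `Λ = γ⁻¹ℤ^{n[M:ℚ]}`; but the twist `γ` of ★ FILE 7a
(`exists_rat_conj_entries_mem_integralFiniteAdeles_of_commute`) is chosen from `(K, L₀)` and the order `res(𝓞_M • 1)` ONLY — it never sees
`ξ`.  Hence every member of an arbitrary family `ξᵢ` receives a frame `βᵢ = Tᵢ ∘ γ` (`Tᵢ ∈ GL(ℤ)`) on the SAME lattice, and since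
`ũ_{βᵢ}(p) = Tᵢ·(γ·res(p)·γ⁻¹)·Tᵢ′` with `Tᵢ, Tᵢ′` integer inverse matrices, the congruence `ũ_{βᵢ}(p) ≡ 1 (mod m)` is read on
`γ·res(p)·γ⁻¹` alone (★ `isCongOne_intConjRect_iff`): `auxLevelV βᵢ m = auxLevelV βᵢ' m` for all `m, i, i′`.

* §1 `mem_auxLevelV_iff_isCongOne_conj` (the level in lattice currency: `p ∈ K̃_β(m) ↔ γ·res(p)·γ⁻¹ ≡ 1 ≡ γ·res(p)⁻¹·γ⁻¹ (mod m)`),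
  **`auxLevelV_eq_of_framePV_eq`** (two frames on one lattice have equal levels — any `ξ ξ′ g g′ δ δ′`).
* §2 `exists_latticeTwist` (the common twist `γ`: `K × L₀`-stable and `𝓞_M`-stable, `ξ`-free),
  `exists_symplecticFrameV_integralAction_of_twist` (★ 7b at a PRESCRIBED twist `γ`, frame matrix `P = T·γ` exposed).
* §3 HEAD **`exists_symplecticFrameV_family_integralAction`**: for ANY family `ξ : ι → M` of nonzero purely imaginary scalars, frames
  `Frᵢ` of `kᵢ•ψ_{ξᵢ}` with integer `𝓞_M`-readings `ρᵢ`, `K × L₀ ≤ K̃_{βᵢ}(1)`, AND `∀ m i i′, auxLevelV (Fr i) m = auxLevelV (Fr i′) m`.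

## References
* [Deligne1971TravauxShimura] P. Deligne, *Travaux de Shimura*, Sém. Bourbaki 389 (1971), Prop. 1.15 p. 132, Exemple 4.16 p. 150.
* [Deligne1979ShimuraVarieties] P. Deligne, *Variétés de Shimura* (1979), Prop. 2.3.10 (PDF p. 32 of Milne's translation).
* [Kottwitz1992] R. Kottwitz, *Points on some Shimura varieties over finite fields*, JAMS 5 (1992), §5 p. 390.
* [RapoportSmithlingZhang2020Diagonal] M. Rapoport, B. Smithling, W. Zhang, Compos. Math. 156 (2020), Remark 3.2 (ii)(iii) pp. 9–10, §4.1 p. 17.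
* [PlatonovRapinchuk1994] V. Platonov, A. Rapinchuk, *Algebraic groups and number theory* (1994), §8.1.
-/

set_option autoImplicit false

noncomputable section

open Matrix NumberField IsDedekindDomain
open scoped TensorProduct
open Literature.AlgebraicGeometry.ModuliOfAbelianVarieties Literature.LinearAlgebra.FreeModule
open Literature.NumberTheory.Automorphic (integralFiniteAdeles)

namespace Literature.AlgebraicGeometry.ShimuraVarieties

namespace UnitaryCurve

namespace AuxV

open Literature.AlgebraicGeometry.ShimuraVarieties.UnitaryCanonicalModel.Aux (ratBasis torusFinAdelic torusToTensorFin map_intCast_mul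
  isCongOne_one_of_forall_mem_integral forall_mem_integral_intConj isCongOne_intConjRect_iff)
open Literature.AlgebraicGeometry.ShimuraVarieties.UnitaryCurve.Aux (unitaryToTensorFin)
open Literature.NumberTheory.Automorphic Literature.NumberTheory.Automorphic.UnitaryGroup

/-! ### §1. The level sees only the lattice -/

section Level

variable {L : Type} [Field L] [NumberField L] [IsCMField L] {M : Type} [Field M] [NumberField M] [IsCMField M]
  {j : L →+* M} {n : ℕ} {H : Matrix (Fin n) (Fin n) L} {ξ ξ' : M} {g g' : ℕ} {δ : Fin g → ℕ} {δ' : Fin g' → ℕ}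

/-- **The auxiliary level in LATTICE currency**: if the frame matrix is `P = T·γ` with `T, T′` integer inverse matrices and `γ ∈ GL(ℚ)`, then
`p ∈ K̃_β(m)` iff `γ·res(p)·γ⁻¹ ≡ 1 (mod m)` and `γ·res(p)⁻¹·γ⁻¹ ≡ 1 (mod m)` — the congruence condition of `p` on the lattice `γ⁻¹ℤ^{n[M:ℚ]}`,
with NO reference to the form `ψ_ξ` or to the frame. [cite: Deligne1971TravauxShimura, Prop. 1.15 p. 132 and Exemple 4.16 p. 150]
[cite: Deligne1979ShimuraVarieties, Prop. 2.3.10 (PDF p. 32)] -/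
theorem mem_auxLevelV_iff_isCongOne_conj (F : SymplecticFrameV M j H ξ g δ)
    (γ : GL (Fin n × Fin (Module.finrank ℚ M)) ℚ)
    (T : Matrix (Fin g ⊕ Fin g) (Fin n × Fin (Module.finrank ℚ M)) ℤ) (T' : Matrix (Fin n × Fin (Module.finrank ℚ M)) (Fin g ⊕ Fin g) ℤ)
    (hTT' : T * T' = 1) (hT'T : T' * T = 1)
    (hP : framePV F = T.map (Int.cast : ℤ → ℚ) * ((γ : GL (Fin n × Fin (Module.finrank ℚ M)) ℚ) :
      Matrix (Fin n × Fin (Module.finrank ℚ M)) (Fin n × Fin (Module.finrank ℚ M)) ℚ))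
    (m : ℕ) (p : ↥(finAdelic (↥(maximalRealSubfield L)) L (IsCMField.complexConj L) n H) × ↥(torusFinAdelic M)) :
    p ∈ auxLevelV F m ↔
      IsCongOne m ((Matrix.GeneralLinearGroup.map (algebraMap ℚ finAdeleQ) γ * auxResFinV M j H p *
          (Matrix.GeneralLinearGroup.map (algebraMap ℚ finAdeleQ) γ)⁻¹ : GL (Fin n × Fin (Module.finrank ℚ M)) finAdeleQ) :
            Matrix (Fin n × Fin (Module.finrank ℚ M)) (Fin n × Fin (Module.finrank ℚ M)) finAdeleQ) ∧
      IsCongOne m ((Matrix.GeneralLinearGroup.map (algebraMap ℚ finAdeleQ) γ * (auxResFinV M j H p)⁻¹ *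
          (Matrix.GeneralLinearGroup.map (algebraMap ℚ finAdeleQ) γ)⁻¹ : GL (Fin n × Fin (Module.finrank ℚ M)) finAdeleQ) :
            Matrix (Fin n × Fin (Module.finrank ℚ M)) (Fin n × Fin (Module.finrank ℚ M)) finAdeleQ) := by
  classical
  set γm : Matrix (Fin n × Fin (Module.finrank ℚ M)) (Fin n × Fin (Module.finrank ℚ M)) ℚ :=
    ((γ : GL (Fin n × Fin (Module.finrank ℚ M)) ℚ) : Matrix (Fin n × Fin (Module.finrank ℚ M)) (Fin n × Fin (Module.finrank ℚ M)) ℚ)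
    with hγm
  set γi : Matrix (Fin n × Fin (Module.finrank ℚ M)) (Fin n × Fin (Module.finrank ℚ M)) ℚ :=
    ((γ⁻¹ : GL (Fin n × Fin (Module.finrank ℚ M)) ℚ) : Matrix (Fin n × Fin (Module.finrank ℚ M)) (Fin n × Fin (Module.finrank ℚ M)) ℚ)
    with hγi
  have hγim : γi * γm = 1 := by rw [hγm, hγi, ← Units.val_mul, inv_mul_cancel, Units.val_one]
  set Tq : Matrix (Fin g ⊕ Fin g) (Fin n × Fin (Module.finrank ℚ M)) ℚ := T.map (Int.cast : ℤ → ℚ) with hTq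
  set T'q : Matrix (Fin n × Fin (Module.finrank ℚ M)) (Fin g ⊕ Fin g) ℚ := T'.map (Int.cast : ℤ → ℚ) with hT'q
  have hT'Tq : T'q * Tq = 1 := by
    rw [hTq, hT'q, ← map_intCast_mul, hT'T, Matrix.map_one Int.cast Int.cast_zero Int.cast_one]
  have hQ : frameQV F = γi * T'q := by
    have h1 : (γi * T'q) * framePV F = 1 := by
      rw [hP, Matrix.mul_assoc, ← Matrix.mul_assoc T'q, hT'Tq, Matrix.one_mul, hγim]
    calc frameQV F = (γi * T'q) * framePV F * frameQV F := by rw [h1, Matrix.one_mul]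
      _ = γi * T'q := by rw [Matrix.mul_assoc, framePV_mul_frameQV, Matrix.mul_one]
  -- over `𝔸_{ℚ,f}`
  set ι𝔸 : ℚ →+* finAdeleQ := algebraMap ℚ finAdeleQ with hι
  have hPA : framePVR finAdeleQ F = T.map (Int.cast : ℤ → finAdeleQ) * γm.map ι𝔸 := by
    rw [framePVR, hP, ← hι, Matrix.map_mul, Matrix.map_map]
    congr 1
    ext a ik
    simp only [Matrix.map_apply, Function.comp_apply, map_intCast]
  have hQA : frameQVR finAdeleQ F = γi.map ι𝔸 * T'.map (Int.cast : ℤ → finAdeleQ) := by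
    rw [frameQVR, hQ, ← hι, Matrix.map_mul, hT'q, Matrix.map_map]
    congr 1
    ext ik a
    simp only [Matrix.map_apply, Function.comp_apply, map_intCast]
  have hγA : ((Matrix.GeneralLinearGroup.map ι𝔸 γ : GL (Fin n × Fin (Module.finrank ℚ M)) finAdeleQ) :
      Matrix (Fin n × Fin (Module.finrank ℚ M)) (Fin n × Fin (Module.finrank ℚ M)) finAdeleQ) = γm.map ι𝔸 := rfl
  have hγA' : (((Matrix.GeneralLinearGroup.map ι𝔸 γ)⁻¹ : GL (Fin n × Fin (Module.finrank ℚ M)) finAdeleQ) :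
      Matrix (Fin n × Fin (Module.finrank ℚ M)) (Fin n × Fin (Module.finrank ℚ M)) finAdeleQ) = γi.map ι𝔸 := by
    rw [← map_inv]; rfl
  have key : ∀ Z : GL (Fin n × Fin (Module.finrank ℚ M)) finAdeleQ,
      IsCongOne m (framePVR finAdeleQ F *
        (Z : Matrix (Fin n × Fin (Module.finrank ℚ M)) (Fin n × Fin (Module.finrank ℚ M)) finAdeleQ) * frameQVR finAdeleQ F) ↔
      IsCongOne m ((Matrix.GeneralLinearGroup.map ι𝔸 γ * Z * (Matrix.GeneralLinearGroup.map ι𝔸 γ)⁻¹ :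
        GL (Fin n × Fin (Module.finrank ℚ M)) finAdeleQ) :
          Matrix (Fin n × Fin (Module.finrank ℚ M)) (Fin n × Fin (Module.finrank ℚ M)) finAdeleQ) := by
    intro Z
    have hmul : framePVR finAdeleQ F * (Z : Matrix (Fin n × Fin (Module.finrank ℚ M)) (Fin n × Fin (Module.finrank ℚ M)) finAdeleQ) *
          frameQVR finAdeleQ F =
        T.map (Int.cast : ℤ → finAdeleQ) *
            (γm.map ι𝔸 * (Z : Matrix (Fin n × Fin (Module.finrank ℚ M)) (Fin n × Fin (Module.finrank ℚ M)) finAdeleQ) * γi.map ι𝔸) *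
          T'.map (Int.cast : ℤ → finAdeleQ) := by
      rw [hPA, hQA]
      simp only [Matrix.mul_assoc]
    rw [hmul, Units.val_mul, Units.val_mul, hγA, hγA']
    exact isCongOne_intConjRect_iff _ T T' hTT' hT'T
  rw [mem_auxLevelV_iff, mem_principalLevelSubgroup_iff, coe_auxToGspFinV_eq_conjRect, ← map_inv]
  simp only [coe_conjRect]
  exact and_congr (key _) (key _)

/-- **TWO FRAMES ON ONE LATTICE HAVE THE SAME AUXILIARY LEVELS** (the «COMMON LATTICE» law): if `β = T ∘ γ` and `β′ = S ∘ γ` for the SAME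
`γ ∈ GL(ℚ)` and integer invertible `T`, `S` — two symplectic frames, of possibly different forms `ψ_ξ`, `ψ_{ξ′}`, ranks `g, g′` and types
`δ, δ′`, adapted to the one lattice `γ⁻¹ℤ^{n[M:ℚ]}` — then `K̃_β(m) = K̃_{β′}(m)` for every `m`.
[cite: Deligne1971TravauxShimura, Prop. 1.15 p. 132 and Exemple 4.16 p. 150] [cite: Kottwitz1992, §5 p. 390] -/
theorem auxLevelV_eq_of_framePV_eq (F : SymplecticFrameV M j H ξ g δ) (F' : SymplecticFrameV M j H ξ' g' δ')
    (γ : GL (Fin n × Fin (Module.finrank ℚ M)) ℚ)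
    (T : Matrix (Fin g ⊕ Fin g) (Fin n × Fin (Module.finrank ℚ M)) ℤ) (T' : Matrix (Fin n × Fin (Module.finrank ℚ M)) (Fin g ⊕ Fin g) ℤ)
    (hTT' : T * T' = 1) (hT'T : T' * T = 1)
    (hP : framePV F = T.map (Int.cast : ℤ → ℚ) * ((γ : GL (Fin n × Fin (Module.finrank ℚ M)) ℚ) :
      Matrix (Fin n × Fin (Module.finrank ℚ M)) (Fin n × Fin (Module.finrank ℚ M)) ℚ))
    (S : Matrix (Fin g' ⊕ Fin g') (Fin n × Fin (Module.finrank ℚ M)) ℤ) (S' : Matrix (Fin n × Fin (Module.finrank ℚ M)) (Fin g' ⊕ Fin g') ℤ)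
    (hSS' : S * S' = 1) (hS'S : S' * S = 1)
    (hP' : framePV F' = S.map (Int.cast : ℤ → ℚ) * ((γ : GL (Fin n × Fin (Module.finrank ℚ M)) ℚ) :
      Matrix (Fin n × Fin (Module.finrank ℚ M)) (Fin n × Fin (Module.finrank ℚ M)) ℚ))
    (m : ℕ) : auxLevelV F m = auxLevelV F' m := by
  ext p
  rw [mem_auxLevelV_iff_isCongOne_conj F γ T T' hTT' hT'T hP m p, mem_auxLevelV_iff_isCongOne_conj F' γ S S' hSS' hS'S hP' m p]

end Level

/-! ### §2. The common twist and the frame at a prescribed twist -/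

section Twist

variable {L : Type} [Field L] [NumberField L] [IsCMField L] {M : Type} [Field M] [NumberField M] [IsCMField M]
  (j : L →+* M) {n : ℕ} (H : Matrix (Fin n) (Fin n) L)

/-- **THE COMMON LATTICE** (★ FILE 7a, `ξ`-free): for compact `K ≤ U(H)(𝔸_f)`, `L₀ ≤ T₀(M)(𝔸_f)` there is `γ ∈ GL_{n[M:ℚ]}(ℚ)` such that the
lattice `Λ = γ⁻¹ℤ^{n[M:ℚ]} ⊂ M^n` is stable under `K × L₀` (through the frame-free carrier ★ `auxResFinV`, together with inverses) AND under
the order `𝓞_M` (`γ·res(b•1)·γ⁻¹` is an integer matrix).  NO form `ψ_ξ` enters. [cite: Kottwitz1992, §5 p. 390]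
[cite: PlatonovRapinchuk1994, §8.1] [cite: Deligne1979ShimuraVarieties, Prop. 2.3.10 (PDF p. 32)] -/
theorem exists_latticeTwist
    (K : Subgroup ↥(finAdelic (↥(maximalRealSubfield L)) L (IsCMField.complexConj L) n H))
    (L₀ : Subgroup ↥(torusFinAdelic M))
    (hK : IsCompact (K : Set ↥(finAdelic (↥(maximalRealSubfield L)) L (IsCMField.complexConj L) n H)))
    (hL₀ : IsCompact (L₀ : Set ↥(torusFinAdelic M))) :
    ∃ γ : GL (Fin n × Fin (Module.finrank ℚ M)) ℚ,
      (∀ p ∈ K.prod L₀,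
        (∀ i i', ((Matrix.GeneralLinearGroup.map (algebraMap ℚ finAdeleQ) γ * auxResFinV M j H p *
            (Matrix.GeneralLinearGroup.map (algebraMap ℚ finAdeleQ) γ)⁻¹ : GL (Fin n × Fin (Module.finrank ℚ M)) finAdeleQ) :
              Matrix (Fin n × Fin (Module.finrank ℚ M)) (Fin n × Fin (Module.finrank ℚ M)) finAdeleQ) i i' ∈ integralFiniteAdeles ℚ) ∧
        (∀ i i', ((Matrix.GeneralLinearGroup.map (algebraMap ℚ finAdeleQ) γ * (auxResFinV M j H p)⁻¹ *
            (Matrix.GeneralLinearGroup.map (algebraMap ℚ finAdeleQ) γ)⁻¹ : GL (Fin n × Fin (Module.finrank ℚ M)) finAdeleQ) :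
              Matrix (Fin n × Fin (Module.finrank ℚ M)) (Fin n × Fin (Module.finrank ℚ M)) finAdeleQ) i i' ∈ integralFiniteAdeles ℚ)) ∧
      ∀ b : 𝓞 M, ∀ i i', ∃ z : ℤ,
        (((γ : GL (Fin n × Fin (Module.finrank ℚ M)) ℚ) : Matrix (Fin n × Fin (Module.finrank ℚ M)) (Fin n × Fin (Module.finrank ℚ M)) ℚ) *
            resMatrix (m := Fin n) (ratBasis M) (((b : 𝓞 M) : M) • (1 : Matrix (Fin n) (Fin n) M)) *
          ((γ⁻¹ : GL (Fin n × Fin (Module.finrank ℚ M)) ℚ) :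
            Matrix (Fin n × Fin (Module.finrank ℚ M)) (Fin n × Fin (Module.finrank ℚ M)) ℚ)) i i' = (z : ℚ) := by
  classical
  -- the compact image `C` of `K × L₀` under the frame-free carrier
  set C : Subgroup (GL (Fin n × Fin (Module.finrank ℚ M)) finAdeleQ) := (K.prod L₀).map (auxResFinV M j H) with hC
  have hCc : IsCompact (C : Set (GL (Fin n × Fin (Module.finrank ℚ M)) finAdeleQ)) := by
    rw [hC, Subgroup.coe_map, Subgroup.coe_prod]
    exact (hK.prod hL₀).image (continuous_auxResFinV M j H)
  -- the order `res(𝓞_M • 1)` through an integral basis, and its commutation with `C`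
  let σ : 𝓞 M →+* Matrix (Fin n × Fin (Module.finrank ℚ M)) (Fin n × Fin (Module.finrank ℚ M)) ℚ :=
    (resMatrix (m := Fin n) (ratBasis M)).comp ((algebraMap M (Matrix (Fin n) (Fin n) M)).comp (algebraMap (𝓞 M) M))
  have hσ : ∀ b : 𝓞 M, σ b = resMatrix (m := Fin n) (ratBasis M) (((b : 𝓞 M) : M) • (1 : Matrix (Fin n) (Fin n) M)) := fun b => by
    simp only [σ, RingHom.comp_apply, Algebra.algebraMap_eq_smul_one]
  let bO := RingOfIntegers.basis M
  let S : Module.Free.ChooseBasisIndex ℤ (𝓞 M) → Matrix (Fin n × Fin (Module.finrank ℚ M)) (Fin n × Fin (Module.finrank ℚ M)) ℚ :=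
    fun l => σ (bO l)
  have hspan : ∀ b : 𝓞 M, σ b ∈ Submodule.span ℤ (Set.range S) := by
    intro b
    have hb : b ∈ Submodule.span ℤ (Set.range bO) := by rw [bO.span_eq]; trivial
    rw [show Set.range S = σ.toIntAlgHom.toLinearMap '' Set.range bO from by
      rw [← Set.range_comp]; rfl, Submodule.span_image]
    exact Submodule.mem_map_of_mem hb
  have h1 : (1 : Matrix _ _ ℚ) ∈ Submodule.span ℤ (Set.range S) := by
    have h := hspan 1
    rwa [map_one] at h
  have hmul : ∀ l l', S l * S l' ∈ Submodule.span ℤ (Set.range S) := fun l l' => by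
    have h := hspan (bO l * bO l')
    rwa [map_mul] at h
  have hcommσ : ∀ (b : 𝓞 M) (p : ↥(finAdelic (↥(maximalRealSubfield L)) L (IsCMField.complexConj L) n H) × ↥(torusFinAdelic M)),
      (σ b).map (algebraMap ℚ finAdeleQ) * ((auxResFinV M j H p : GL (Fin n × Fin (Module.finrank ℚ M)) finAdeleQ) :
          Matrix (Fin n × Fin (Module.finrank ℚ M)) (Fin n × Fin (Module.finrank ℚ M)) finAdeleQ) =
        ((auxResFinV M j H p : GL (Fin n × Fin (Module.finrank ℚ M)) finAdeleQ) :
          Matrix (Fin n × Fin (Module.finrank ℚ M)) (Fin n × Fin (Module.finrank ℚ M)) finAdeleQ) * (σ b).map (algebraMap ℚ finAdeleQ) := by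
    intro b p
    rw [hσ, resMatrix_map_algebraMap, coe_auxResFinV, ← map_mul, ← map_mul,
      Matrix.map_smul' _ _ _ (map_mul (Algebra.TensorProduct.includeRight : M →ₐ[ℚ] finAdeleQ ⊗[ℚ] M)),
      Matrix.map_one _ (map_zero _) (map_one _), smul_one_mul, mul_smul_one]
  have hcomm : ∀ l, ∀ c ∈ C, (S l).map (algebraMap ℚ finAdeleQ) * (c : Matrix _ _ finAdeleQ) =
      (c : Matrix _ _ finAdeleQ) * (S l).map (algebraMap ℚ finAdeleQ) := by
    intro l c hc
    rw [hC] at hc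
    obtain ⟨p, -, rfl⟩ := Subgroup.mem_map.mp hc
    exact hcommσ (bO l) p
  obtain ⟨γ, hγ, hγS⟩ :=
    Literature.NumberTheory.Adeles.exists_rat_conj_entries_mem_integralFiniteAdeles_of_commute C hCc S h1 hmul hcomm
  refine ⟨γ, fun p hp => hγ _ (by rw [hC]; exact Subgroup.mem_map_of_mem _ hp), fun b i i' => ?_⟩
  -- `γ σ(b) γ⁻¹` is integral: `σ(b)` is a `ℤ`-combination of the `S l`
  obtain ⟨a, ha⟩ := (Submodule.mem_span_range_iff_exists_fun ℤ).mp (hspan b)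
  choose z hz using fun l => hγS l i i'
  refine ⟨∑ l, a l * z l, ?_⟩
  rw [← hσ, ← ha, Finset.mul_sum, Finset.sum_mul, Matrix.sum_apply, Int.cast_sum]
  refine Finset.sum_congr rfl fun l _ => ?_
  rw [mul_smul_comm, smul_mul_assoc, Matrix.smul_apply, hz l, zsmul_eq_mul, Int.cast_mul]

variable (ξ : M)

/-- **★ 7b AT A PRESCRIBED TWIST** (Deligne's auxiliary construction with Kottwitz's `𝒪_B`-lattice, the lattice GIVEN): for `H^j` hermitian, `H`
invertible, `ξ` nonzero purely imaginary, `n ≠ 0`, and a twist `γ` whose lattice `γ⁻¹ℤ^{n[M:ℚ]}` is `K × L₀`-stable and `𝓞_M`-stable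
(★ `exists_latticeTwist`), there are `k > 0`, `g > 0`, a polarisation type `δ`, a symplectic frame `Fr` of type `δ` for `k•ψ_ξ` with frame matrix
`P = T·γ` (`T, T′` integer inverse matrices — `Fr` is adapted to THAT lattice), `K × L₀ ≤ K̃_{Fr}(1)`, and an integer reading
`ρ : 𝓞 M →+* M_{2g}(ℤ)` of the `𝓞_M`-action with `(ρ b)_ℚ = P·res(b•1)·Q`. [cite: Kottwitz1992, §5 p. 390]
[cite: Deligne1979ShimuraVarieties, Prop. 2.3.10 (PDF p. 32)] [cite: RapoportSmithlingZhang2020Diagonal, Remark 3.2 (ii)(iii) pp. 9–10, §4.1 p. 17] -/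
theorem exists_symplecticFrameV_integralAction_of_twist [NeZero n] (hH : (H.map j)ᴴ = H.map j) (hHu : IsUnit H) (hξ : ξ ≠ 0)
    (hξc : IsCMField.complexConj M ξ = -ξ)
    (K : Subgroup ↥(finAdelic (↥(maximalRealSubfield L)) L (IsCMField.complexConj L) n H))
    (L₀ : Subgroup ↥(torusFinAdelic M))
    (γ : GL (Fin n × Fin (Module.finrank ℚ M)) ℚ)
    (hγ : ∀ p ∈ K.prod L₀,
      (∀ i i', ((Matrix.GeneralLinearGroup.map (algebraMap ℚ finAdeleQ) γ * auxResFinV M j H p *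
          (Matrix.GeneralLinearGroup.map (algebraMap ℚ finAdeleQ) γ)⁻¹ : GL (Fin n × Fin (Module.finrank ℚ M)) finAdeleQ) :
            Matrix (Fin n × Fin (Module.finrank ℚ M)) (Fin n × Fin (Module.finrank ℚ M)) finAdeleQ) i i' ∈ integralFiniteAdeles ℚ) ∧
      (∀ i i', ((Matrix.GeneralLinearGroup.map (algebraMap ℚ finAdeleQ) γ * (auxResFinV M j H p)⁻¹ *
          (Matrix.GeneralLinearGroup.map (algebraMap ℚ finAdeleQ) γ)⁻¹ : GL (Fin n × Fin (Module.finrank ℚ M)) finAdeleQ) :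
            Matrix (Fin n × Fin (Module.finrank ℚ M)) (Fin n × Fin (Module.finrank ℚ M)) finAdeleQ) i i' ∈ integralFiniteAdeles ℚ))
    (hγS : ∀ b : 𝓞 M, ∀ i i', ∃ z : ℤ,
      (((γ : GL (Fin n × Fin (Module.finrank ℚ M)) ℚ) : Matrix (Fin n × Fin (Module.finrank ℚ M)) (Fin n × Fin (Module.finrank ℚ M)) ℚ) *
          resMatrix (m := Fin n) (ratBasis M) (((b : 𝓞 M) : M) • (1 : Matrix (Fin n) (Fin n) M)) *
        ((γ⁻¹ : GL (Fin n × Fin (Module.finrank ℚ M)) ℚ) : Matrix (Fin n × Fin (Module.finrank ℚ M)) (Fin n × Fin (Module.finrank ℚ M)) ℚ))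
        i i' = (z : ℚ)) :
    ∃ (k g : ℕ) (δ : Fin g → ℕ) (Fr : SymplecticFrameV M j H ((k : ℚ) • ξ) g δ)
      (T : Matrix (Fin g ⊕ Fin g) (Fin n × Fin (Module.finrank ℚ M)) ℤ) (T' : Matrix (Fin n × Fin (Module.finrank ℚ M)) (Fin g ⊕ Fin g) ℤ)
      (ρ : 𝓞 M →+* Matrix (Fin g ⊕ Fin g) (Fin g ⊕ Fin g) ℤ),
      0 < k ∧ 0 < g ∧ IsPolarizationType δ ∧ T * T' = 1 ∧ T' * T = 1 ∧
      framePV Fr = T.map (Int.cast : ℤ → ℚ) * ((γ : GL (Fin n × Fin (Module.finrank ℚ M)) ℚ) :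
        Matrix (Fin n × Fin (Module.finrank ℚ M)) (Fin n × Fin (Module.finrank ℚ M)) ℚ) ∧
      K.prod L₀ ≤ auxLevelV Fr 1 ∧
        ∀ b : 𝓞 M, (ρ b).map (Int.cast : ℤ → ℚ) =
          framePV Fr * resMatrix (m := Fin n) (ratBasis M) (((b : 𝓞 M) : M) • (1 : Matrix (Fin n) (Fin n) M)) * frameQV Fr := by
  classical
  -- the `γ`-twisted rational basis `c` and the integral frame adapted to it
  set e : Module.Basis (Fin n × Fin (Module.finrank ℚ M)) ℚ (Fin n → M) := resBasis (m := Fin n) (ratBasis M) with he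
  set γm : Matrix (Fin n × Fin (Module.finrank ℚ M)) (Fin n × Fin (Module.finrank ℚ M)) ℚ :=
    ((γ : GL (Fin n × Fin (Module.finrank ℚ M)) ℚ) : Matrix (Fin n × Fin (Module.finrank ℚ M)) (Fin n × Fin (Module.finrank ℚ M)) ℚ)
    with hγm
  set γi : Matrix (Fin n × Fin (Module.finrank ℚ M)) (Fin n × Fin (Module.finrank ℚ M)) ℚ :=
    ((γ⁻¹ : GL (Fin n × Fin (Module.finrank ℚ M)) ℚ) : Matrix (Fin n × Fin (Module.finrank ℚ M)) (Fin n × Fin (Module.finrank ℚ M)) ℚ)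
    with hγi
  have hγmi : γm * γi = 1 := by rw [hγm, hγi, ← Units.val_mul, mul_inv_cancel, Units.val_one]
  have hγim : γi * γm = 1 := by rw [hγm, hγi, ← Units.val_mul, inv_mul_cancel, Units.val_one]
  let θγ : ((Fin n × Fin (Module.finrank ℚ M)) → ℚ) ≃ₗ[ℚ] ((Fin n × Fin (Module.finrank ℚ M)) → ℚ) :=
    LinearEquiv.ofLinear (Matrix.toLin' γm) (Matrix.toLin' γi)
      (by rw [← Matrix.toLin'_mul, hγmi, Matrix.toLin'_one])
      (by rw [← Matrix.toLin'_mul, hγim, Matrix.toLin'_one])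
  let c : Module.Basis (Fin n × Fin (Module.finrank ℚ M)) ℚ (Fin n → M) := Module.Basis.ofEquivFun (e.equivFun.trans θγ)
  have hc : ∀ u, c.equivFun u = γm *ᵥ e.equivFun u := fun u => by
    rw [Module.Basis.equivFun_ofEquivFun]
    exact Matrix.toLin'_apply γm _
  obtain ⟨k, g, δ, F, T, T', hk, hg, hδ, hTT', hT'T, -, hβ⟩ := exists_symplecticFrameV_integral j H ξ c hH hHu hξ hξc
  have hes : ∀ ik, e.equivFun (e ik) = Pi.single ik 1 := fun ik => by
    rw [Module.Basis.equivFun_apply, e.repr_self, Finsupp.single_eq_pi_single]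
  have hP : framePV F = T.map (Int.cast : ℤ → ℚ) * γm := by
    ext a ik
    rw [framePV, LinearMap.toMatrix_apply, Pi.basisFun_repr, LinearEquiv.coe_coe, ← he, hβ, hc, hes, Matrix.mulVec_mulVec,
      Matrix.mulVec_single_one, Matrix.col_apply]
  obtain ⟨ρ, hρ⟩ := exists_ringHom_reading_of_framePV_eq F γ T T' hT'T hP hγS
  exact ⟨k, g, δ, F, T, T', ρ, hk, hg, hδ, hTT', hT'T, hP, prod_le_auxLevelV_one_of_framePV_eq F K L₀ γ hγ T T' hT'T hP, hρ⟩

end Twist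

/-! ### §3. HEAD: one lattice, every skew scalar, equal levels -/

section Family

variable {L : Type} [Field L] [NumberField L] [IsCMField L] {M : Type} [Field M] [NumberField M] [IsCMField M]
  (j : L →+* M) {n : ℕ} (H : Matrix (Fin n) (Fin n) L) {ι : Type} (ξ : ι → M)

/-- **THE `𝒪`-ACTION READS INTEGRALLY IN ADAPTED FRAMES ON ONE COMMON LATTICE, FOR A WHOLE FAMILY OF SKEW SCALARS** (★ 7b
`exists_symplecticFrameV_integralAction` for an ARBITRARY family `ξ : ι → M` — no finiteness — with the «COMMON LATTICE» law): for `H^j`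
hermitian, `H` invertible, every `ξᵢ` nonzero purely imaginary, `n ≠ 0` and compact `K ≤ U(H)(𝔸_f)`, `L₀ ≤ T₀(M)(𝔸_f)`, there are, for
every `i`, `kᵢ > 0`, `gᵢ > 0`, a polarisation type `δᵢ`, a symplectic frame `Frᵢ` of type `δᵢ` for `kᵢ•ψ_{ξᵢ}` and an integer ring homomorphism
`ρᵢ : 𝓞 M →+* M_{2gᵢ}(ℤ)` with `K × L₀ ≤ K̃_{Frᵢ}(1)` and `(ρᵢ b)_ℚ = Pᵢ·res(b•1)·Qᵢ`; AND all the frames sit on ONE lattice, so that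
**`auxLevelV (Fr i) m = auxLevelV (Fr i') m` for all `m, i, i′`** — in the E-line (`M = L = F`, `j = id`, `L₀ = ⊥`,
`bᵢ := ũ_{Frᵢ} ∘ inl`): `bᵢ⁻¹K_{δᵢ}(N) = bᵢ'⁻¹K_{δᵢ'}(N)`, one saturated level `Kc ⊓ b⁻¹K(N)` for every frame.
[cite: Kottwitz1992, §5 p. 390] [cite: Deligne1979ShimuraVarieties, Prop. 2.3.10 (PDF p. 32)]
[cite: Deligne1971TravauxShimura, Prop. 1.15 p. 132 and Exemple 4.16 p. 150] [cite: RapoportSmithlingZhang2020Diagonal, Remark 3.2 (ii)(iii) pp. 9–10, §4.1 p. 17] -/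
theorem exists_symplecticFrameV_family_integralAction [NeZero n] (hH : (H.map j)ᴴ = H.map j) (hHu : IsUnit H) (hξ : ∀ i, ξ i ≠ 0)
    (hξc : ∀ i, IsCMField.complexConj M (ξ i) = -ξ i)
    (K : Subgroup ↥(finAdelic (↥(maximalRealSubfield L)) L (IsCMField.complexConj L) n H))
    (L₀ : Subgroup ↥(torusFinAdelic M))
    (hK : IsCompact (K : Set ↥(finAdelic (↥(maximalRealSubfield L)) L (IsCMField.complexConj L) n H)))
    (hL₀ : IsCompact (L₀ : Set ↥(torusFinAdelic M))) :
    ∃ (k g : ι → ℕ) (δ : (i : ι) → Fin (g i) → ℕ) (Fr : (i : ι) → SymplecticFrameV M j H ((k i : ℚ) • ξ i) (g i) (δ i))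
      (ρ : (i : ι) → 𝓞 M →+* Matrix (Fin (g i) ⊕ Fin (g i)) (Fin (g i) ⊕ Fin (g i)) ℤ),
      (∀ i, 0 < k i ∧ 0 < g i ∧ IsPolarizationType (δ i) ∧ K.prod L₀ ≤ auxLevelV (Fr i) 1 ∧
        ∀ b : 𝓞 M, (ρ i b).map (Int.cast : ℤ → ℚ) =
          framePV (Fr i) * resMatrix (m := Fin n) (ratBasis M) (((b : 𝓞 M) : M) • (1 : Matrix (Fin n) (Fin n) M)) * frameQV (Fr i)) ∧
      ∀ (m : ℕ) (i i' : ι), auxLevelV (Fr i) m = auxLevelV (Fr i') m := by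
  classical
  obtain ⟨γ, hγ, hγS⟩ := exists_latticeTwist j H K L₀ hK hL₀
  have h := fun i => exists_symplecticFrameV_integralAction_of_twist j H (ξ i) hH hHu (hξ i) (hξc i) K L₀ γ hγ hγS
  choose k g δ Fr T T' ρ hk hg hδ hTT' hT'T hP hlvl hρ using h
  exact ⟨k, g, δ, Fr, ρ, fun i => ⟨hk i, hg i, hδ i, hlvl i, hρ i⟩,
    fun m i i' => auxLevelV_eq_of_framePV_eq (Fr i) (Fr i') γ (T i) (T' i) (hTT' i) (hT'T i) (hP i) (T i') (T' i') (hTT' i') (hT'T i') (hP i') m⟩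

end Family

end AuxV

end UnitaryCurve

end Literature.AlgebraicGeometry.ShimuraVarieties

end
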